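import Literature.MathematicalPhysics.QuantumFieldTheory.YangMillsOS

/-!
# Lead c3 certificate: `IsYangMillsFor` is idle in `stub_thresholdUniformity` of `Lines/birth.lean`

With `c ≡ 0` every smeared lattice field vanishes identically, so the vacuum-only datum inhabits
`IsYangMillsFor r sch T` for EVERY `(a, β, L)`; since `HasLatticeMassGap` and the pair-uniform threshold
clause read `sch` only through `(a, β, L)`, the stub is equivalent to a `T`-free statement about Wilson
lattice gauge theory at an arbitrary real coupling sequence.
-/

noncomputable section

open scoped SchwartzMap
open MeasureTheory Filter Topology
open Literature.MathematicalPhysics.AQFT Literature.MathematicalPhysics.QuantumLattice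
open Literature.MathematicalPhysics.QuantumFieldTheory

namespace Summit.QuantumFields.YangMills.Cruxes.GapToContinuum.BirthC3

variable {G : Type} [Group G] [TopologicalSpace G] [IsTopologicalGroup G] [CompactSpace G]
  [MeasurableSpace G] [BorelSpace G]

/-- The scheme `sch` with its renormalisations switched off (`c ≡ 0`, `m ≡ 0`): same `(a, β, L)`. -/
def switchOff (sch : SpeciesScheme (YMSpecies G)) : SpeciesScheme (YMSpecies G) where
  a := sch.a
  a_pos := sch.a_pos
  tendsto_a := sch.tendsto_a
  β := sch.β
  L := sch.L
  tendsto_L := sch.tendsto_L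
  c := fun _ _ => 0
  m := fun _ _ => 0

/-- With `c ≡ 0` the vacuum-only datum IS "Yang–Mills along `sch`" — for every `(a, β, L)`. -/
theorem isYangMillsFor_vacuum_of_c_eq_zero (r : LatticeRep G) (sch : SpeciesScheme (YMSpecies G))
    (hc : ∀ s k, sch.c s k = 0) : IsYangMillsFor r sch (OSData.vacuum (YMSpecies G) 4) := by
  intro n hn σ f F _ _
  have hS : (OSData.vacuum (YMSpecies G) 4).schwinger n σ F = 0 := by
    simp [OSData.vacuum, LabelledSchwingerFamily.trivial_of_ne_zero (YMSpecies G) hn]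
  rw [hS]
  refine tendsto_const_nhds.congr' (Eventually.of_forall fun k => ?_)
  show (0 : ℂ) = ((latticeSchwinger r.ρ sch (fun s => s.F) k n σ f : ℝ) : ℂ)
  obtain ⟨j, rfl⟩ := Nat.exists_eq_succ_of_ne_zero hn
  simp [latticeSchwinger, smearedLatticeField, hc]

/-- `HasLatticeMassGap` does not read the renormalisations. -/
theorem hasLatticeMassGap_switchOff_iff (r : LatticeRep G) (sch : SpeciesScheme (YMSpecies G)) (Δ : ℝ) :
    HasLatticeMassGap r (switchOff sch) Δ ↔ HasLatticeMassGap r sch Δ := Iff.rfl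

/-- The pair-uniform threshold clause (conclusion of `stub_thresholdUniformity`), as a predicate. -/
def UniformThreshold (r : LatticeRep G) (sch : SpeciesScheme (YMSpecies G)) (Δ : ℝ) : Prop :=
  ∃ k₀ : ℕ, ∀ A B : YMSpecies G, ∃ C : ℝ, ∀ k : ℕ, k₀ ≤ k → ∀ S : ℕ, sch.L k ≤ S →
    ∀ n : ℕ, n ≤ S →
      |latticeConnectedCorr r.ρ (sch.β k) (2 * S + 1) A.F B.F n| ≤
        C * Real.exp (-(Δ * (sch.a k * n)))

/-- **`stub_thresholdUniformity` (at fixed `G`) is equivalent to the `T`-free lattice statement**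
`∀ r sch Δ, 0 < Δ → HasLatticeMassGap r sch Δ → UniformThreshold r sch Δ`: the hypothesis
`IsYangMillsFor r sch T` is idle (inhabited by the vacuum datum after switching the renormalisations off,
which changes neither the hypothesis nor the conclusion). -/
theorem stub_thresholdUniformity_iff_latticeOnly :
    (∀ (r : LatticeRep G) (sch : SpeciesScheme (YMSpecies G)) (T : OSData (YMSpecies G) 4) (Δ : ℝ),
        0 < Δ → IsYangMillsFor r sch T → HasLatticeMassGap r sch Δ → UniformThreshold r sch Δ) ↔
      ∀ (r : LatticeRep G) (sch : SpeciesScheme (YMSpecies G)) (Δ : ℝ),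
        0 < Δ → HasLatticeMassGap r sch Δ → UniformThreshold r sch Δ := by
  constructor
  · intro h r sch Δ hΔ hgap
    exact h r (switchOff sch) (OSData.vacuum _ 4) Δ hΔ
      (isYangMillsFor_vacuum_of_c_eq_zero r _ fun _ _ => rfl) hgap
  · intro h r sch T Δ hΔ _ hgap
    exact h r sch Δ hΔ hgap

end Summit.QuantumFields.YangMills.Cruxes.GapToContinuum.BirthC3

end
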